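import Summits.HodgeConjecture.HodgeConjecture.Theorems.F0P2oBorelEigenfunctionalOfJacquetModule   -- ★ p827685: transport lemma, functional pattern; N3/N3ᵟ letters
import Summits.HodgeConjecture.HodgeConjecture.Theorems.F0P2oXThetaOwnClass                       -- ★ p05: irreducible/smooth `xThetaCM`, `πH`, `πG`
import Summits.HodgeConjecture.HodgeConjecture.Theorems.F0P2oU1DisjointOfTower                    -- ★ p828521: `continuous_units_of_coe`
import Summits.HodgeConjecture.HodgeConjecture.Theorems.F0P2oK1occ                               -- ★ p01: `continuous_of_isThetaCenterChar`
import Summits.HodgeConjecture.HodgeConjecture.Theorems.F0P2oSupercuspidalNeConstituent           -- ★ p02 (g6): `not_isConstituentOf_cmPrincipalSeries_of_isSupercuspidal` (under N6)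
import Summits.HodgeConjecture.HodgeConjecture.Theorems.F0P3XiPacketFamilyOfRecord                -- ★ `isAdmissible_of_isConstituentOf`
import Summits.HodgeConjecture.HodgeConjecture.Theorems.F0P3XiUnramNonsplitInstance               -- ★ `isAdmissible_cmPrincipalSeries`
import Literature.NumberTheory.Rogawski1990.U3SquareIntegrabilityExponentCriterion                 -- ★ N7 LETTER (typ-T7b): `u3_squareIntegrable_jacquetExponent_decay`
import Literature.NumberTheory.Rogawski1990.U3SupercuspidalJacquetCriterion                        -- ★ N6 LETTER (typ-T7a): `u3_isSupercuspidal_iff_jacquet_eq_zero`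
import Literature.NumberTheory.Automorphic.IrreducibleClassesConstituentsIsotypic                   -- ★ `IsConstituentOf.of_isIsotypicOfType`
import Literature.NumberTheory.Automorphic.CMLocalRingModulusContinuous                           -- ★ `continuous_cmXiTorusChar_fst`
import Literature.NumberTheory.Automorphic.CMPrincipalSeriesJacquetEvalOne                         -- ★ `continuous_torusCharPair_apply`
import Literature.NumberTheory.Automorphic.CMXiTorusCharSplitTorusDecay                           -- ★ `exists_map_eq_unitModulusChar_lt_one`
import Literature.NumberTheory.Automorphic.JacquetModuleExactProofs                               -- ★ `jacquetMap_surjective`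
import HarnessLib

/-!
# Crux `H413`, programme P2 — LABEL «THE OCCURRING THETA TYPE IS NOT SQUARE-INTEGRABLE» (T7b `StubThetaTypeNotL2`, Lines-free, from the letters N3, N6, N7)

Cell hodgecm-mathlib (D-0151), FLOOR 0, crux H413 = stmt-HodgeConjecture-24833; lead B-p18 (g28); capital for the D7α re-cut (director s609 (iii): open = {LABEL, N6 (⇐), N9}).
The statement is the body of `StubThetaTypeNotL2` of `F0/P2/Lines-draft/T7b_LocalThetaDichotomy.lean` v1.5 (:225–246, repaired per F0P2-p01 15:35:24Z) VERBATIM with the Lines-local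
`CenterCharSpec` spelled by its token-identical ★ Literature twin `IsThetaCenterChar` (folds by δ).  Print: the non-tempered member `πⁿ(ξ_v)` of the local A-packet is the theta
type [GelbartRogawski1991 Lem. 5.1.2; §5.2 p. 467], and it is NOT square-integrable [Rogawski1990 §12.2 (2) p. 174: «`π²(ξ)` is the unique square-integrable constituent,
`πⁿ(ξ)` the remaining (non-tempered) one»]; here: its Jacquet module carries the RAW exponent `μ_v‖·‖^{1/2} ⊗ ψθ` (letter N3 [GR91 §3.2 (3.2.2); Kudla86 Thm. 2.8]),
which violates Casselman's square-integrability criterion (letter N7 [Casselman1995 Thm. 4.4.6]) at `d(a,1,a⁻¹)`, `‖a‖ < 1`: `‖a‖^{1/2} ≮ ‖a‖`.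
Ingredients (all ★ but the three letters): (i) `ThetaTypeAtCM` + irreducibility ⇒ the square-integrable representative is EQUIVALENT to `πG = X_v ∘ κ_v⁻¹ ∘ congr`
(§1: a simple module whose `X`-isotypic component is `⊤` is a constituent of `X`, ★ `IsConstituentOf.of_isIsotypicOfType` + ★ `nonempty_equiv_of_isIrreducible`);
(ii) constituent of `i_G(χθ)` ⇒ Jacquet module `≠ 0` (letter N6 + ★ `not_isConstituentOf_cmPrincipalSeries_of_isSupercuspidal`); (iii) N3 (b) transported along the
equivalence gives a non-zero `(M, χθ)`-map on the Jacquet module; (iv) N7.  THEOREMS ONLY; conditional on the named facts `hN3`, `hN6`, `hN7` only.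
HC_CM is proved only modulo the printed citations until rung 0 closes; nothing here proves a letter.

## References
* [Rogawski1990] Ann. of Math. Stud. 123: §12.2 (2) pp. 173–174.  [Casselman1995] Thm. 4.4.6.  [GelbartRogawski1991] §3.2 (3.2.1)–(3.2.2) p. 457; Lem. 5.1.2; §5.2 p. 467.
* [Kudla1986] Thm. 2.8.  [BernsteinZelevinsky1977] §1.8–1.9, 2.3.  [BushnellHenniart2006] §1.1.  [BourbakiAlgebreVIII2012] VIII §4 n°2.
-/

set_option autoImplicit false
-- the mandated namespace has the single-problem summit's repeated segment (`HodgeConjecture.HodgeConjecture`)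
set_option linter.dupNamespace false

noncomputable section

open NumberField IsDedekindDomain MeasureTheory
open scoped Matrix NNReal

open Literature.NumberTheory Literature.NumberTheory.Automorphic Literature.NumberTheory.Automorphic.UnitaryGroup
open Literature.NumberTheory.Automorphic.IdeleClassGroup
open Literature.NumberTheory.Automorphic.Liu2021 Literature.NumberTheory.Automorphic.Liu2021.Def411WeilCarriers
open Literature.NumberTheory.GaloisRepresentations
open Literature.NumberTheory.Rogawski1990
open Literature.NumberTheory.GelbartRogawski1991
open Literature.RepresentationTheory

namespace Summit.HodgeConjecture.HodgeConjecture.Cruxes.H413.F0P2oThetaTypeNotL2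

/-! ## §1 «Is the theta type» forces an equivalence with `X_v ∘ κ_v⁻¹` -/

section ThetaType

variable (L : Type) [Field L] [NumberField L] [IsCMField L] (H : Matrix (Fin 3) (Fin 3) L) {n' : ℕ} (e₁ : Fin 3 × Fin 1 ≃ Fin n')
    (dV : Fin 3 → L) (hdV : ∀ i, IsCMField.complexConj L (dV i) = dV i) (hdV0 : ∀ i, dV i ≠ 0) (g : GL (Fin 3) L)
    (hg : ((g : Matrix (Fin 3) (Fin 3) L).map (cmConjRingHom L))ᵀ * H * (g : Matrix (Fin 3) (Fin 3) L) = Matrix.diagonal dV)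
    (μ : Literature.NumberTheory.Automorphic.IdeleClassGroup L →ₜ* Circle) (hμ : IsConjugateSymplectic L μ)
    (χf : UnitaryGroup.finAdelicOne (↥(maximalRealSubfield L)) L (IsCMField.complexConj L) →* ℂˣ)
    (hcont : Continuous χf) (hunit : ∀ z, ‖((χf z : ℂˣ) : ℂ)‖ = 1) (ε : (↥(maximalRealSubfield L))ˣ)
    (v : HeightOneSpectrum (𝓞 ↥(maximalRealSubfield L)))

include hcont hunit in
set_option synthInstance.maxHeartbeats 400000 in
set_option maxHeartbeats 16000000 in
/-- **A class which IS the theta type (★ `ThetaTypeAtCM`) is the class of `X_v(μ,ε,χ_f) ∘ κ_v⁻¹`**: every irreducible smooth representative `r` of the class (read on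
`U(H)(L⁺_v)` through ★ `localPiEquiv`) is equivalent to `πH := X_v ∘ κ_v⁻¹` — apply the predicate to `τ := ρ′ := r.ρ` (a simple module is its own isotypic component), so `r.ρ` is
`πH`-isotypic, hence a constituent of the irreducible `πH` (★ `IsConstituentOf.of_isIsotypicOfType`), hence equivalent to it (★ `nonempty_equiv_of_isIrreducible`).
[cite: BushnellHenniart2006, §1.1] [cite: BourbakiAlgebreVIII2012, VIII §4 n°2] -/
theorem nonempty_equiv_of_thetaTypeAtCM (c : IrrClass ((cmDatum L 3 H).Local v))
    (hθ : ThetaTypeAtCM L H e₁ dV hdV hdV0 g hg μ hμ χf ε v c)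
    (r : SmoothIrrep ↥(localPi L (IsCMField.complexConj L) 3 H v))
    (hr : IrrClass.mk r = IrrClass.comap (localPiEquiv L (IsCMField.complexConj L) 3 H v) c) :
    Nonempty (r.ρ.Equiv
      ((xThetaCM L e₁ dV hdV hdV0 μ hμ χf ε v :
        localPi L (IsCMField.complexConj L) 3 (Matrix.diagonal dV) v →* _).comp
      (localCongr L (IsCMField.complexConj L) g one_ne_zero (by rw [one_smul]; exact hg) v).symm.toMulEquiv.toMonoidHom)) := by
  haveI : r.ρ.IsIrreducible := r.isIrreducible
  haveI hπ : Representation.IsIrreducible ((xThetaCM L e₁ dV hdV hdV0 μ hμ χf ε v :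
        localPi L (IsCMField.complexConj L) 3 (Matrix.diagonal dV) v →* _).comp
      (localCongr L (IsCMField.complexConj L) g one_ne_zero (by rw [one_smul]; exact hg) v).symm.toMulEquiv.toMonoidHom) :=
    F0P2oThetaTypeOwnClass.isIrreducible_piH L H e₁ dV hdV hdV0 g hg μ hμ χf ε v
      (F0P2oXThetaOwnClass.isIrreducible_xThetaCM L e₁ dV hdV hdV0 μ hμ χf hcont hunit ε v)
  haveI : IsSimpleModule (MonoidAlgebra ℂ ↥(localPi L (IsCMField.complexConj L) 3 H v)) r.ρ.asModule :=
    (Representation.irreducible_iff_isSimpleModule_asModule r.ρ).1 inferInstance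
  -- `r.ρ` is its own isotypic component
  have hself : isotypicComponent (MonoidAlgebra ℂ ↥(localPi L (IsCMField.complexConj L) 3 H v)) r.ρ.asModule r.ρ.asModule = ⊤ :=
    isotypicComponent_eq_top_iff.2 (IsIsotypicOfType.of_isSimpleModule _ _)
  have hconst : (IrrClass.comap (localPiEquiv L (IsCMField.complexConj L) 3 H v) c).IsConstituentOf r.ρ := by
    rw [← hr]; exact IrrClass.isConstituentOf_mk_self r
  have htop := hθ r.V r.ρ r.isIrreducible hconst r.V r.ρ hself
  have h2 : (IrrClass.mk r).IsConstituentOf ((xThetaCM L e₁ dV hdV hdV0 μ hμ χf ε v :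
        localPi L (IsCMField.complexConj L) 3 (Matrix.diagonal dV) v →* _).comp
      (localCongr L (IsCMField.complexConj L) g one_ne_zero (by rw [one_smul]; exact hg) v).symm.toMulEquiv.toMonoidHom) :=
    (IrrClass.isConstituentOf_mk_self r).of_isIsotypicOfType (IsIsotypicOfType.of_isotypicComponent_eq_top htop)
  exact h2.nonempty_equiv_of_isIrreducible

end ThetaType

/-! ## §1b Transport of an equivalence along two pull-backs (generic; keeps the elaborator off `(r.comap e).V = r.V` at concrete groups) -/

section Generic

universe u

variable {G₁ G₂ G₃ : Type u} [Group G₁] [TopologicalSpace G₁] [Group G₂] [TopologicalSpace G₂] [Group G₃] [TopologicalSpace G₃]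

/-- **An equivalence `(r ∘ e₁) ∘ e₂ ≅ π` is a linear isomorphism `E : r.V ≃ W` with `E (r.ρ g x) = π (e₂⁻¹ (e₁⁻¹ g)) (E x)`** (the pull-back ★ `SmoothIrrep.comap`
keeps the space; stated generically so that no `((r.comap e₁).comap e₂).V = r.V` is ever unfolded at concrete groups). [cite: BushnellHenniart2006, §1.1] -/
theorem exists_linearEquiv_of_comap_comap_equiv (e₁ : G₂ ≃ₜ* G₁) (e₂ : G₃ ≃ₜ* G₂) (r : SmoothIrrep G₁)
    {W : Type*} [AddCommGroup W] [Module ℂ W] {π : Representation ℂ G₃ W} (eH : ((r.comap e₁).comap e₂).ρ.Equiv π) :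
    ∃ E : r.V ≃ₗ[ℂ] W, ∀ (g : G₁) (x : r.V), E (r.ρ g x) = π (e₂.symm (e₁.symm g)) (E x) := by
  refine ⟨eH.toLinearEquiv, fun g x => ?_⟩
  have h := Representation.IntertwiningMap.isIntertwining _ _ eH.toIntertwiningMap (e₂.symm (e₁.symm g)) x
  rw [SmoothIrrep.comap_ρ_apply, SmoothIrrep.comap_ρ_apply, ContinuousMulEquiv.apply_symm_apply,
    ContinuousMulEquiv.apply_symm_apply] at h
  exact h

end Generic

/-! ## §2 Continuity of `χθ = μ_v‖·‖^{1/2} ⊗ ψθ` -/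

section Continuity

variable (L : Type) [Field L] [NumberField L] [IsCMField L]

set_option synthInstance.maxHeartbeats 400000 in
set_option maxHeartbeats 4000000 in
/-- **`χθ = cmXiTorusChar L v μ_v ψθ⁻¹ ψθ` is continuous** when `ψθ` is the theta centre character of a continuous `χ_f` (★ `continuous_of_isThetaCenterChar`,
★ `continuous_cmXiTorusChar_fst`, ★ `continuous_torusCharPair_apply`). [cite: Rogawski1990, §12.1 p. 172] -/
theorem continuous_cmXiTorusChar_theta (μ : Literature.NumberTheory.Automorphic.IdeleClassGroup L →ₜ* Circle)
    (χf : UnitaryGroup.finAdelicOne (↥(maximalRealSubfield L)) L (IsCMField.complexConj L) →* ℂˣ) (hcont : Continuous χf)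
    (ε : (↥(maximalRealSubfield L))ˣ) (v : HeightOneSpectrum (𝓞 ↥(maximalRealSubfield L)))
    (ψθ : ↥(normOneUnits (conjLocal L (IsCMField.complexConj L) v)) →* ℂˣ) (hspec : IsThetaCenterChar L μ χf ε v ψθ) :
    Continuous fun t => ((cmXiTorusChar L v ((toHeckeCharacter L μ).semilocalComponent L v) ψθ⁻¹ ψθ t : ℂˣ) : ℂ) := by
  have hψ : Continuous fun β => ((ψθ β : ℂˣ) : ℂ) := F0P2oK1occ.continuous_of_isThetaCenterChar L μ χf hcont ε v ψθ hspec
  have hψinv : Continuous fun β => ((ψθ⁻¹ β : ℂˣ) : ℂ) := by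
    simp only [MonoidHom.inv_apply, Units.val_inv_eq_inv_val]
    exact hψ.inv₀ fun β => (ψθ β).ne_zero
  have hμc : Continuous fun x => ((((toHeckeCharacter L μ).semilocalComponent L v) x : ℂˣ) : ℂ) :=
    Units.continuous_val.comp (continuous_semilocalComponent L (toHeckeCharacter L μ))
  have h1 := continuous_cmXiTorusChar_fst L v ((toHeckeCharacter L μ).semilocalComponent L v) ψθ⁻¹ hμc hψinv
  exact continuous_torusCharPair_apply (conjLocal L (IsCMField.complexConj L) v) (cmLocalForm L 3 v) (cmLocalForm_eq_over L 3 v) 0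
    ((ψθ⁻¹).comp (quotConj (conjLocal L (IsCMField.complexConj L) v) (conjLocal_conjLocal_cm L v)) *
      (toHeckeCharacter L μ).semilocalComponent L v * halfModulusChar (UnitaryGroup.LocalRing L v)) ψθ h1 hψ

end Continuity

/-! ## §3 The value of `χθ` at `d(a, 1, a⁻¹)` -/

section Torus

variable (L : Type) [Field L] [NumberField L] [IsCMField L] (v : HeightOneSpectrum (𝓞 ↥(maximalRealSubfield L)))

set_option maxHeartbeats 1600000 in
/-- **At `t₀ = d(a,1,a⁻¹)` with `σ a = a`: `‖χθ(t₀)‖ = √‖a‖`** (`a/ā = 1`, `det t₀ = 1`, `|μ_v(a)| = 1` by ★ `isUnitary_toHeckeCharacter`). [cite: Rogawski1990, §12.2 p. 174] -/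
theorem norm_cmXiTorusChar_diag (μ : Literature.NumberTheory.Automorphic.IdeleClassGroup L →ₜ* Circle)
    (ψθ : ↥(normOneUnits (conjLocal L (IsCMField.complexConj L) v)) →* ℂˣ) (a : (UnitaryGroup.LocalRing L v)ˣ)
    (haσ : conjLocal L (IsCMField.complexConj L) v (a : UnitaryGroup.LocalRing L v) = a)
    (t₀ : ↥(torusU (conjLocal L (IsCMField.complexConj L) v) (cmLocalForm L 3 v)))
    (ht₀ : glDiagonal 3 (UnitaryGroup.LocalRing L v) ![a, 1, a⁻¹] =
      ((t₀ : ↥(unitaryGroupOfForm (conjLocal L (IsCMField.complexConj L) v) (cmLocalForm L 3 v))) : GL (Fin 3) (UnitaryGroup.LocalRing L v))) :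
    ‖((cmXiTorusChar L v ((toHeckeCharacter L μ).semilocalComponent L v) ψθ⁻¹ ψθ t₀ : ℂˣ) : ℂ)‖ =
      ((NNReal.sqrt (unitModulusChar (UnitaryGroup.LocalRing L v) a) : ℝ≥0) : ℝ) := by
  have hte : torusEntry (conjLocal L (IsCMField.complexConj L) v) (cmLocalForm L 3 v) 0 t₀ = a :=
    torusEntry_eq_of_glDiagonal_eq _ _ 0 t₀ ![a, 1, a⁻¹] ht₀
  have hdet : torusDetNormOne (conjLocal L (IsCMField.complexConj L) v) (cmLocalForm L 3 v) (cmLocalForm_eq_over L 3 v) t₀ = 1 := by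
    apply Subtype.ext
    rw [coe_torusDetNormOne, torusDet_eq_of_glDiagonal_eq _ _ t₀ ![a, 1, a⁻¹] ht₀, Fin.prod_univ_three]
    simp
  have haσ' : Units.map (conjLocal L (IsCMField.complexConj L) v : UnitaryGroup.LocalRing L v →* UnitaryGroup.LocalRing L v) a = a :=
    Units.ext haσ
  have hq : quotConj (conjLocal L (IsCMField.complexConj L) v) (conjLocal_conjLocal_cm L v) a = 1 := by
    apply Subtype.ext
    rw [coe_quotConj, haσ', mul_inv_cancel]
    rfl
  have hμ1 : ‖(((toHeckeCharacter L μ).semilocalComponent L v a : ℂˣ) : ℂ)‖ = 1 := by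
    rw [semilocalComponent_apply]
    exact isUnitary_toHeckeCharacter L μ _
  rw [cmXiTorusChar, xiTorusChar_apply, hte, hdet, hq]
  simp only [map_one, one_mul, mul_one, Units.val_mul, norm_mul, hμ1, coe_halfModulusChar_apply,
    Complex.norm_real, Real.norm_eq_abs, NNReal.abs_eq]

end Torus

/-! ## §4 LABEL -/

set_option synthInstance.maxHeartbeats 400000 in
set_option maxHeartbeats 16000000 in
/-- **LABEL — the theta type, if a constituent of `i_G(χθ)`, is NOT square-integrable** (T7b `StubThetaTypeNotL2` body VERBATIM with `CenterCharSpec` ↦ ★ `IsThetaCenterChar`).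
Proof: a square-integrable representative `r₀` of `x₀` is EQUIVALENT to `πG = X_v ∘ κ_v⁻¹ ∘ congr` (§1 at the class transported to `U(H)(L⁺_v)`); its Jacquet module is non-zero
(`x₀` a constituent of the principal series, letter N6 + ★ `not_isConstituentOf_cmPrincipalSeries_of_isSupercuspidal`) and injects (★ `jacquetMap_cmBorel_injective`) into that of
`X_v` read on `U(Φ₃)(L⁺_v)`, on which the torus acts by the RAW `χθ = μ_v‖·‖^{1/2} ⊗ ψθ` (letter N3); so the torus acts by `χθ` on `r_N(r₀.ρ)` and any non-zero functional is a
`(T, χθ)`-map; letter N7 at `d(a,1,a⁻¹)`, `σ a = a`, `‖a‖ < 1` (★ `exists_map_eq_unitModulusChar_lt_one`) gives `√‖a‖ < ‖a‖`, absurd.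
[cite: Rogawski1990, §12.2 (2) pp. 173–174] [cite: Casselman1995, Thm. 4.4.6] [cite: GelbartRogawski1991, §3.2 (3.2.2) p. 457; §5.2 p. 467 L25–27] -/
theorem thetaType_not_squareIntegrable
    (hN3 : Literature.NumberTheory.GelbartRogawski1991.thetaType_nonsplit_jacquetModule)
    (hN6 : Literature.NumberTheory.Rogawski1990.u3_isSupercuspidal_iff_jacquet_eq_zero)
    (hN7 : Literature.NumberTheory.Rogawski1990.u3_squareIntegrable_jacquetExponent_decay) :
  ∀ (L : Type) [Field L] [NumberField L] [IsCMField L] (H : Matrix (Fin 3) (Fin 3) L) (hH : (H.map (cmConjRingHom L))ᵀ = H) (hHd : IsUnit H.det)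
    {n' : ℕ} (e₁ : Fin 3 × Fin 1 ≃ Fin n') (dV : Fin 3 → L) (hdV : ∀ i, IsCMField.complexConj L (dV i) = dV i) (hdV0 : ∀ i, dV i ≠ 0) (g : GL (Fin 3) L)
    (hg : ((g : Matrix (Fin 3) (Fin 3) L).map (cmConjRingHom L))ᵀ * H * (g : Matrix (Fin 3) (Fin 3) L) = Matrix.diagonal dV),
    ∀ (μ : Literature.NumberTheory.Automorphic.IdeleClassGroup L →ₜ* Circle) (hμ : IsConjugateSymplectic L μ)
      (χf : UnitaryGroup.finAdelicOne (↥(maximalRealSubfield L)) L (IsCMField.complexConj L) →* ℂˣ),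
      Continuous χf → (∀ z, ‖((χf z : ℂˣ) : ℂ)‖ = 1) →
      ∀ (v : HeightOneSpectrum (𝓞 ↥(maximalRealSubfield L))),
        (∀ w : PlacesOver L v, IsCMField.complexConj L • w.1 = w.1) →
        ∀ (T : GL (Fin 3) (UnitaryGroup.LocalRing L v)) (a : UnitaryGroup.LocalRing L v) (ha : IsUnit a)
          (h : formCongr (conjLocal L (IsCMField.complexConj L) v) T (H.map (algebraMap L (UnitaryGroup.LocalRing L v))) =
            a • (Matrix.of fun i j : Fin 3 => if i.val + j.val + 1 = 3 then (1 : L) else 0).map (algebraMap L (UnitaryGroup.LocalRing L v)))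
          (ε : (↥(maximalRealSubfield L))ˣ) (x₀ : IrrClass (Gqs L v)) (ψθ : ↥(normOneUnits (conjLocal L (IsCMField.complexConj L) v)) →* ℂˣ),
          IsThetaCenterChar L μ χf ε v ψθ →
          x₀.IsConstituentOf (cmPrincipalSeries L 3 v (cmXiTorusChar L v ((toHeckeCharacter L μ).semilocalComponent L v) ψθ⁻¹ ψθ)) →
          ThetaTypeAtCM L H e₁ dV hdV hdV0 g hg μ hμ χf ε v (IrrClass.comap (cmDatumLocalCongr L v T ha h).symm x₀) →
          ∀ [MeasurableSpace (Gqs L v ⧸ Subgroup.center (Gqs L v))] [BorelSpace (Gqs L v ⧸ Subgroup.center (Gqs L v))]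
            (μZ : Measure (Gqs L v ⧸ Subgroup.center (Gqs L v))) [μZ.IsHaarMeasure], ¬ x₀.IsSquareIntegrable μZ := by
  intro L _ _ _ H hH hHd n' e₁ dV hdV hdV0 g hg μ hμ χf hcont hunit v hv T a ha h ε x₀ ψθ hspec hconst hθ _ _ μZ _ hL2
  obtain ⟨r₀, hr₀, hL2'⟩ := hL2
  haveI := locallyCompactSpace_cmBorelU L 3 v
  -- (ii) the Jacquet module of `r₀` is non-zero
  have hnt : Nontrivial ((cmBorelTriple L 3 v).restrict r₀.ρ).Coinvariants := by
    by_contra hsub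
    rw [not_nontrivial_iff_subsingleton] at hsub
    have hsc : x₀.IsSupercuspidal := hr₀ ▸ (hN6 L v hv r₀).2 hsub
    exact F0P2oSupercuspidalNeConstituent.not_isConstituentOf_cmPrincipalSeries_of_isSupercuspidal L v hN6 hv _ x₀ hsc hconst
  -- (i) `r₀.ρ ≅ πG`: the representative transported to `U(H)(L⁺_v)`
  obtain ⟨eH⟩ := nonempty_equiv_of_thetaTypeAtCM L H e₁ dV hdV hdV0 g hg μ hμ χf hcont hunit ε v
    (IrrClass.comap (cmDatumLocalCongr L v T ha h).symm x₀) hθ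
    ((r₀.comap (cmDatumLocalCongr L v T ha h).symm).comap (localPiEquiv L (IsCMField.complexConj L) 3 H v))
    (by rw [← hr₀]; rfl)
  -- N3 read along the transported form congruence `T′ = g_v⁻¹ T`
  have h' := F0P2oBorelEigenfunctionalOfJacquetModule.formCongr_inv_toLocalGL_mul_eq L hg v T h
  obtain ⟨-, hTorus⟩ := hN3 L e₁ dV hdV hdV0 (Equiv.prodUnique (Fin 1) (Fin 1)) μ hμ χf hcont hunit v hv ε ψθ hspec
    ((toLocalGL L v g)⁻¹ * T) a ha h'
  -- a linear isomorphism `E : r₀.V ≃ W` intertwining `r₀.ρ` with `ρ′ = X_v ∘ localPiEquiv⁻¹ ∘ congr_{T′}` (generic §1b + ★ transport lemma)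
  obtain ⟨E, hE⟩ := exists_linearEquiv_of_comap_comap_equiv (cmDatumLocalCongr L v T ha h).symm
    (localPiEquiv L (IsCMField.complexConj L) 3 H v) r₀ eH
  have hint : ∀ (u : Gqs L v) (x : r₀.V),
      E (r₀.ρ u x) = xThetaGqsCM L e₁ dV hdV hdV0 μ hμ χf ε v ((toLocalGL L v g)⁻¹ * T) ha h' u (E x) := by
    intro u x
    have h1 := hE u x
    rw [ContinuousMulEquiv.symm_symm] at h1
    have h2 := congrArg (xThetaCM L e₁ dV hdV hdV0 μ hμ χf ε v :
        localPi L (IsCMField.complexConj L) 3 (Matrix.diagonal dV) v →* _)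
      (F0P2oBorelEigenfunctionalOfJacquetModule.localCongr_symm_localPiEquiv_symm_cmDatumLocalCongr L hg v T ha h u)
    exact h1.trans (LinearMap.congr_fun h2 _)
  have hint' : ∀ (u : Gqs L v) (y : _),
      E.symm (xThetaGqsCM L e₁ dV hdV hdV0 μ hμ χf ε v ((toLocalGL L v g)⁻¹ * T) ha h' u y) = r₀.ρ u (E.symm y) := by
    intro u y
    apply E.injective
    rw [LinearEquiv.apply_symm_apply, hint, LinearEquiv.apply_symm_apply]
  -- the intertwiners `G₀ : r₀.ρ → ρ′`, `G₁ : ρ′ → r₀.ρ` and the injectivity of `r_N(G₀)` (it has the left inverse `r_N(G₁)`)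
  let G₀ : r₀.ρ.IntertwiningMap (xThetaGqsCM L e₁ dV hdV hdV0 μ hμ χf ε v ((toLocalGL L v g)⁻¹ * T) ha h') :=
    (E.toLinearMap).intertwiningMap_of_isIntertwiningMap _ _ (fun u x => hint u x)
  let G₁ : Representation.IntertwiningMap (xThetaGqsCM L e₁ dV hdV hdV0 μ hμ χf ε v ((toLocalGL L v g)⁻¹ * T) ha h') r₀.ρ :=
    (E.symm.toLinearMap).intertwiningMap_of_isIntertwiningMap _ _ (fun u y => hint' u y)
  have hleft : Function.LeftInverse (Representation.jacquetMap (cmBorelTriple L 3 v) G₁)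
      (Representation.jacquetMap (cmBorelTriple L 3 v) G₀) := by
    intro x
    obtain ⟨w, rfl⟩ := Representation.Coinvariants.mk_surjective _ x
    rw [Representation.jacquetMap_mk, Representation.jacquetMap_mk]
    exact congrArg (Representation.Coinvariants.mk _) (E.symm_apply_apply w)
  have hJinj : Function.Injective (Representation.jacquetMap (cmBorelTriple L 3 v) G₀) := hleft.injective
  -- the torus acts on `r_N(r₀.ρ)` by the RAW `χθ`
  have hM : ∀ (m : ↥(cmBorelTriple L 3 v).M) (x : ((cmBorelTriple L 3 v).restrict r₀.ρ).Coinvariants),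
      r₀.ρ.jacquetModule (cmBorelTriple L 3 v) m x =
        ((cmXiTorusChar L v ((toHeckeCharacter L μ).semilocalComponent L v) ψθ⁻¹ ψθ m : ℂˣ) : ℂ) • x := by
    intro m x
    apply hJinj
    have hJ := Representation.IntertwiningMap.isIntertwining _ _ (Representation.jacquetMap (cmBorelTriple L 3 v) G₀) m x
    exact hJ.trans ((hTorus m _).trans (map_smul (Representation.jacquetMap (cmBorelTriple L 3 v) G₀) _ x).symm)
  -- a non-zero functional on the (non-zero) Jacquet module is a `(T, χθ)`-map
  obtain ⟨x₁, hx₁⟩ := exists_ne (0 : ((cmBorelTriple L 3 v).restrict r₀.ρ).Coinvariants)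
  obtain ⟨lam, hlam⟩ := Module.Projective.exists_dual_ne_zero ℂ hx₁
  let f : (r₀.ρ.jacquetModule (cmBorelTriple L 3 v)).IntertwiningMap
      ((Representation.trivial ℂ ↥(torusU (conjLocal L (IsCMField.complexConj L) v) (cmLocalForm L 3 v)) ℂ).twist
        (cmXiTorusChar L v ((toHeckeCharacter L μ).semilocalComponent L v) ψθ⁻¹ ψθ)) :=
    lam.intertwiningMap_of_isIntertwiningMap _ _ (fun m x =>
      -- `lam (m • x) = lam (χθ m • x) = χθ m • lam x = (χθ m • 1) (lam x)` (definitional unfolding of `twist` / `trivial`)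
      ((congrArg lam (hM m x)).trans (map_smul lam _ x)).trans
        rfl)
  have hf : f.toLinearMap ≠ 0 := by
    intro h0
    exact hlam (LinearMap.congr_fun h0 x₁)
  -- admissibility of `r₀`
  have hadm : r₀.ρ.IsAdmissible := by
    have hx : x₀.IsAdmissible := F0P3XiPacketFamilyOfRecord.isAdmissible_of_isConstituentOf hconst
      (F0P3XiUnramNonsplitInstance.isAdmissible_cmPrincipalSeries L v _)
    rw [← hr₀] at hx
    exact (IrrClass.isAdmissible_mk r₀).1 hx
  -- N7 at the torus element `t₀ = d(a₀, 1, a₀⁻¹)`, `σ a₀ = a₀`, `‖a₀‖ < 1`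
  obtain ⟨a₀, haσ, ha₀⟩ := exists_map_eq_unitModulusChar_lt_one L v (conjLocal L (IsCMField.complexConj L) v)
  have hmem : glDiagonal 3 (UnitaryGroup.LocalRing L v) ![a₀, 1, a₀⁻¹] ∈
      unitaryGroupOfForm (conjLocal L (IsCMField.complexConj L) v) (cmLocalForm L 3 v) := by
    rw [cmLocalForm_eq_over]
    exact F0P2nBorelCharactersUnipotent.glDiagonal_mem_unitaryGroupOfForm (conjLocal L (IsCMField.complexConj L) v) a₀ haσ
  let t₀ : ↥(torusU (conjLocal L (IsCMField.complexConj L) v) (cmLocalForm L 3 v)) :=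
    ⟨⟨glDiagonal 3 (UnitaryGroup.LocalRing L v) ![a₀, 1, a₀⁻¹], hmem⟩, (mem_torusU_iff _).2 ⟨![a₀, 1, a₀⁻¹], rfl⟩⟩
  have hte : torusEntry (conjLocal L (IsCMField.complexConj L) v) (cmLocalForm L 3 v) 0 t₀ = a₀ :=
    torusEntry_eq_of_glDiagonal_eq _ _ 0 t₀ ![a₀, 1, a₀⁻¹] rfl
  have key := hN7 L v hv μZ r₀.V r₀.ρ r₀.isIrreducible r₀.isSmooth hadm hL2' _
    (continuous_cmXiTorusChar_theta L μ χf hcont ε v ψθ hspec) f hf t₀ (by rw [hte]; exact ha₀)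
  rw [norm_cmXiTorusChar_diag L v μ ψθ a₀ haσ t₀ rfl, hte] at key
  -- `key : √‖a₀‖ < ‖a₀‖` with `0 < ‖a₀‖ < 1`: absurd
  have hs0 : (0 : ℝ) < ((NNReal.sqrt (unitModulusChar (UnitaryGroup.LocalRing L v) a₀) : ℝ≥0) : ℝ) := by
    exact_mod_cast NNReal.sqrt_pos.2 (distribHaarChar_pos (A := UnitaryGroup.LocalRing L v) (g := a₀))
  have hs1 : ((NNReal.sqrt (unitModulusChar (UnitaryGroup.LocalRing L v) a₀) : ℝ≥0) : ℝ) < 1 := by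
    have : NNReal.sqrt (unitModulusChar (UnitaryGroup.LocalRing L v) a₀) < 1 := by
      rw [← NNReal.sqrt_one]; exact NNReal.sqrt_lt_sqrt.2 ha₀
    exact_mod_cast this
  have hsq : ((unitModulusChar (UnitaryGroup.LocalRing L v) a₀ : ℝ≥0) : ℝ) =
      ((NNReal.sqrt (unitModulusChar (UnitaryGroup.LocalRing L v) a₀) : ℝ≥0) : ℝ) ^ 2 := by
    rw [← NNReal.coe_pow, NNReal.sq_sqrt]
  rw [hsq] at key
  nlinarith [key, hs0, hs1]

end Summit.HodgeConjecture.HodgeConjecture.Cruxes.H413.F0P2oThetaTypeNotL2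

end
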